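import Mathlib
import Summits.ResolutionOfSingularities.ResolutionOfSingularities.Theorems.WeightedInvariantLocalWeightedDropNCResSettingLetters
import Summits.ResolutionOfSingularities.ResolutionOfSingularities.Theorems.WeightedInvariantLocalWeightedDropNCGameRank

/-!
# `LocalWeightedDrop`, the NC count game — TOT2-LINE piece S-SET (4/4): **(S1) THE TRANSFORM OF AN ADMISSIBLE DECORATION IS ADMISSIBLE;
# (S4) THE HEAD `(o, c)` DOES NOT RISE**

[OURS · L1 W4.3 · chain w43, engine crux `LocalWeightedDrop` stmt-ResolutionOfSingularities-8899; sub-line under the v32 registered stub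
`stub_spaceNCRankDrop`, design memo `L/res-L1-w43-lead-1/g4/TOT2-LINE.md` v1 §2 (S1)/(S3)/(S4), piece S-SET = res-L1-w43-stub-1; objects of
`…NCResSettingDefs` (p528587), tools of `…NCResSettingStrict` / `…NCResSettingLetters`, radical transport `successor_dvd_pow` of res-L1-w43-lead-1's
`…NCGameRank` (p525270).  MODEL: Cossart–Jannsen–Saito LNM 2270 Def. 3.6/(3.6)/Thm 3.16 in the hypersurface / count-game transcription.
Nothing here is a statement of any manuscript.]

* `strIdx_injOn` — a legal move straightens distinct boundary letters to distinct letters;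
  (`slice_finset_prod` / `not_X_zero_dvd_C_add_X_succ` are res-L1-w43-stub-2's in `…TOT2BridgePoint` (p530471); private copies here;)
* `Decoration.total_chart_eq` — the chart transform of the reduced total equation `f · ∏_{l∈E} x_l` of a B-permissible move: `s^{A_T} · H`, `s ∤ H`,
  with `s · H|_{y_i=0} = (unit) · s · g · ∏_{through-going l} y'_{new l}` (`g` the sliced strict transform of `f`);
* `Decoration.total_transform_eq` — the reduced total equation of the transform: `sqfRep g · s · ∏_{l'' ∈ new letters} y'_{l''}`;
* **(S1) `admissible_transform`** — at every answer `(c, A, G)` and live slot `i` of a B-permissible move from an admissibly decorated position `b`,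
  `δ.transform Φ w c i` is admissible for the new position `s · G|_{y_i = 0}`;
* **(S3)/(S4) `Decoration.o_transform_le`, `Decoration.card_O_transform_le`, `Decoration.head_transform_le`** — `o' ≤ o`, `|O'| ≤ |O|` when
  `o' = o`, and `(o', c') ≤ (o, c)` lexicographically (CJS Thm 3.16); `Decoration.o_transform_lt_of_not_squarefree` — a non-reduced strict
  transform is a head drop.
-/

set_option linter.dupNamespace false -- mandated namespace of this single-conjunct summit

noncomputable section

namespace Summit.ResolutionOfSingularities.ResolutionOfSingularities.Theorems

namespace TameFourTupleDrop

open MvPowerSeries Literature.AlgebraicGeometry.Resolution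

variable {k : Type} [Field k] {m : ℕ}

/-! ## Straightened letters are distinct -/

/-- `x_{l₁} ∣ x_{l₂}` only for `l₁ = l₂`. -/
theorem eq_of_X_dvd_X {n : ℕ} {l₁ l₂ : Fin n} (h : (X l₁ : MvPowerSeries (Fin n) k) ∣ X l₂) : l₁ = l₂ := by
  by_contra hne
  have h1 := X_dvd_iff.mp h (Finsupp.single l₂ 1) (by rw [Finsupp.single_apply, if_neg (Ne.symm hne)])
  rw [coeff_X, if_pos rfl] at h1
  exact one_ne_zero h1

/-- A LEGAL MOVE STRAIGHTENS DISTINCT BOUNDARY LETTERS TO DISTINCT LETTERS: if `Φ_{l₁} = u₁ · x_{l'}` and `Φ_{l₂} = u₂ · x_{l'}` with units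
`u₁` and `Φ` legal, then `l₁ = l₂` (pull back along the inverse coordinate change: `x_{l₁}` and `x_{l₂}` become associates). -/
theorem eq_of_straighten_eq {Φ : Fin (m + 1) → MvPowerSeries (Fin (m + 1)) k} {w : Fin (m + 1) → ℕ} (hmv : IsCountMove Φ w)
    {l₁ l₂ l' : Fin (m + 1)} {u₁ u₂ : MvPowerSeries (Fin (m + 1)) k} (hu₁ : constantCoeff u₁ ≠ 0)
    (h₁ : Φ l₁ = u₁ * X l') (h₂ : Φ l₂ = u₂ * X l') : l₁ = l₂ := by
  obtain ⟨ψ, hψ0, hψΦ, -⟩ := FormalCoordChange.exists_comp_inverse hmv.1 hmv.2.1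
  have hψs : HasSubst ψ := hasSubst_of_constantCoeff_zero hψ0
  have e₁ : (X l₁ : MvPowerSeries (Fin (m + 1)) k) = subst ψ u₁ * ψ l' := by
    rw [← hψΦ l₁, h₁, ← coe_substAlgHom hψs, map_mul, coe_substAlgHom, subst_X hψs]
  have e₂ : (X l₂ : MvPowerSeries (Fin (m + 1)) k) = subst ψ u₂ * ψ l' := by
    rw [← hψΦ l₂, h₂, ← coe_substAlgHom hψs, map_mul, coe_substAlgHom, subst_X hψs]
  have hunit : IsUnit (subst ψ u₁) := by
    rw [isUnit_iff_constantCoeff, constantCoeff_subst_of_constantCoeff_zero ψ hψ0 u₁]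
    exact Ne.isUnit hu₁
  obtain ⟨v, hv⟩ := hunit
  apply eq_of_X_dvd_X (k := k)
  refine ⟨↑v⁻¹ * subst ψ u₂, ?_⟩
  calc (X l₂ : MvPowerSeries (Fin (m + 1)) k) = subst ψ u₂ * ψ l' := e₂
    _ = subst ψ u₂ * (↑v⁻¹ * X l₁) := by rw [e₁, ← hv, Units.inv_mul_cancel_left]
    _ = X l₁ * (↑v⁻¹ * subst ψ u₂) := by ring

/-- The straightened-letter map is injective on the boundary of a decoration under a B-permissible move. -/
theorem strIdx_injOn {δ : Decoration k m} {Φ : Fin (m + 1) → MvPowerSeries (Fin (m + 1)) k} {w : Fin (m + 1) → ℕ}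
    (hperm : IsBPermissible δ Φ w) : Set.InjOn (strIdx Φ) (δ.E : Set (Fin (m + 1))) := by
  intro l₁ h₁ l₂ h₂ h
  obtain ⟨u₁, hu₁, e₁⟩ := strIdx_spec (hperm.2.2.2 l₁ h₁)
  obtain ⟨u₂, hu₂, e₂⟩ := strIdx_spec (hperm.2.2.2 l₂ h₂)
  rw [h] at e₁
  exact eq_of_straighten_eq hperm.1 hu₁ e₁ e₂

open Classical in
/-- The letters of the new boundary: the product over the image is the product over the through-going old letters. -/
theorem Decoration.prod_X_newLetters {δ : Decoration k m} {Φ : Fin (m + 1) → MvPowerSeries (Fin (m + 1)) k} {w : Fin (m + 1) → ℕ}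
    (hperm : IsBPermissible δ Φ w) (c : Fin (m + 1) → k) {i : Fin (m + 1)} (hci : c i ≠ 0) {S : Finset (Fin (m + 1))} (hS : S ⊆ δ.E) :
    ∏ l'' ∈ Decoration.newLetters S Φ c i, (X l'' : MvPowerSeries (Fin (m + 1)) k) =
      ∏ l ∈ S.filter (fun l => c (strIdx Φ l) = 0), X (Fin.predAbove i (Fin.succ (strIdx Φ l))) := by
  unfold Decoration.newLetters
  rw [Finset.prod_image]
  intro l₁ h₁ l₂ h₂ h
  have hl₁ : strIdx Φ l₁ ≠ i := fun h' => hci (h' ▸ (Finset.mem_filter.mp h₁).2)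
  have hl₂ : strIdx Φ l₂ ≠ i := fun h' => hci (h' ▸ (Finset.mem_filter.mp h₂).2)
  exact strIdx_injOn hperm (hS (Finset.mem_filter.mp h₁).1) (hS (Finset.mem_filter.mp h₂).1) (predAbove_succ_injective hl₁ hl₂ h)

/-- The exceptional letter is not a new letter of a through-going component. -/
theorem Decoration.zero_notMem_newLetters (S : Finset (Fin (m + 1))) (Φ : Fin (m + 1) → MvPowerSeries (Fin (m + 1)) k)
    (c : Fin (m + 1) → k) {i : Fin (m + 1)} (hci : c i ≠ 0) : (0 : Fin (m + 1)) ∉ Decoration.newLetters S Φ c i := by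
  classical
  unfold Decoration.newLetters
  intro h
  obtain ⟨l, hl, hl0⟩ := Finset.mem_image.mp h
  have hl' : strIdx Φ l ≠ i := fun h' => hci (h' ▸ (Finset.mem_filter.mp hl).2)
  exact predAbove_succ_ne_zero hl' hl0

open Classical in
/-- THE REDUCED TOTAL EQUATION OF THE TRANSFORM. -/
theorem Decoration.total_transform_eq {δ : Decoration k m} {Φ : Fin (m + 1) → MvPowerSeries (Fin (m + 1)) k} {w : Fin (m + 1) → ℕ}
    (hperm : IsBPermissible δ Φ w) (c : Fin (m + 1) → k) {i : Fin (m + 1)} (hci : c i ≠ 0) :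
    (δ.transform Φ w c i).total = sqfRep (δ.strict Φ w c i) *
      (X 0 * ∏ l ∈ δ.E.filter (fun l => c (strIdx Φ l) = 0), X (Fin.predAbove i (Fin.succ (strIdx Φ l)))) := by
  rw [Decoration.total, Decoration.transform_f, Decoration.transform_E, Finset.prod_insert (Decoration.zero_notMem_newLetters δ.E Φ c hci),
    Decoration.prod_X_newLetters hperm c hci le_rfl]

/-! ## The chart transform of the reduced total equation -/

/-- The slice is multiplicative over finite products (local copy; the tree's `slice_finset_prod` is res-L1-w43-stub-2's, p530471). -/
private theorem slice_finset_prod' {ι : Type} (i : Fin (m + 1)) (s : Finset ι) (f : ι → MvPowerSeries (Fin (m + 1 + 1)) k) :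
    TupleGame.slice i (∏ x ∈ s, f x) = ∏ x ∈ s, TupleGame.slice i (f x) := by
  unfold TupleGame.slice
  rw [← coe_substAlgHom (CobordantChartPlaneSlice.hasSubst_slice (R := k) i), map_prod]


/-- `s` does not divide `c + y_j` (local copy; the tree's `not_X_zero_dvd_C_add_X_succ` is res-L1-w43-stub-2's, p530471). -/
private theorem not_X_zero_dvd_C_add_X_succ' (r : k) (j : Fin (m + 1)) :
    ¬ (X 0 : MvPowerSeries (Fin (m + 1 + 1)) k) ∣ (C r + X j.succ) := by
  intro h
  have h1 := X_dvd_iff.mp h (Finsupp.single j.succ 1) (by rw [Finsupp.single_apply, if_neg (Fin.succ_ne_zero j)])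
  rw [map_add, coeff_C, if_neg (Finsupp.single_ne_zero.mpr one_ne_zero), coeff_X, if_pos rfl, zero_add] at h1
  exact one_ne_zero h1

/-- A substitution through a legal move and a chart preserves constant coefficients (as `constantCoeff_subst_chart_subst`, for one layer). -/
theorem constantCoeff_subst_chart_subst' {w : Fin (m + 1) → ℕ} {c : Fin (m + 1) → k} (hc : ∀ l, w l = 0 → c l = 0)
    (u : MvPowerSeries (Fin (m + 1)) k) : constantCoeff (subst (CobordantChart.chart w c) u) = constantCoeff u := by
  have h := constantCoeff_subst_chart_subst (Φ := fun j => (X j : MvPowerSeries (Fin (m + 1)) k)) (fun j => constantCoeff_X j) hc u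
  rwa [show subst (fun j => (X j : MvPowerSeries (Fin (m + 1)) k)) u = u from congrFun subst_self u] at h


open Classical in
/-- THE CHART TRANSFORM OF THE REDUCED TOTAL EQUATION under a B-permissible move, at an exceptional point `c` and a live slot `i`:
`(f · ∏_{l∈E} x_l)∘Φ∘chart = s^{A_T} · H` with `s ∤ H`, and the new position it defines is, up to a unit, `s · g · ∏_{through-going l} y'_{new l}`
(`g` the sliced strict transform; the boundary components not through the new point become units). -/
theorem Decoration.total_chart_eq {δ : Decoration k m} {Φ : Fin (m + 1) → MvPowerSeries (Fin (m + 1)) k} {w : Fin (m + 1) → ℕ}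
    {c : Fin (m + 1) → k} (hperm : IsBPermissible δ Φ w) (hc : ∀ l, w l = 0 → c l = 0) (hf : δ.f ≠ 0) {i : Fin (m + 1)} (hci : c i ≠ 0) :
    ∃ (AT : ℕ) (H : MvPowerSeries (Fin (m + 1 + 1)) k) (U : MvPowerSeries (Fin (m + 1)) k),
      subst (CobordantChart.chart w c) (subst Φ δ.total) = X 0 ^ AT * H ∧ ¬ X 0 ∣ H ∧ constantCoeff U ≠ 0 ∧
      X 0 * TupleGame.slice i H = U * (δ.strict Φ w c i *
        (X 0 * ∏ l ∈ δ.E.filter (fun l => c (strIdx Φ l) = 0), X (Fin.predAbove i (Fin.succ (strIdx Φ l))))) := by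
  obtain ⟨hmv, -, -, hP3⟩ := hperm
  have hΦs : HasSubst Φ := hasSubst_of_constantCoeff_zero hmv.1
  have hch := CobordantChart.hasSubst_chart w c hc
  have hsl := CobordantChartPlaneSlice.hasSubst_slice (R := k) i
  have hprime := MvPowerSeries.prime_X' k (0 : Fin (m + 1 + 1))
  -- the units straightening the boundary letters
  have key : ∀ l, ∃ u : MvPowerSeries (Fin (m + 1)) k, l ∈ δ.E → constantCoeff u ≠ 0 ∧ Φ l = u * X (strIdx Φ l) := by
    intro l
    by_cases hl : l ∈ δ.E
    · obtain ⟨u, hu, hul⟩ := strIdx_spec (hP3 l hl)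
      exact ⟨u, fun _ => ⟨hu, hul⟩⟩
    · exact ⟨1, fun h => absurd h hl⟩
  choose uf huf using key
  -- the factors `R_l = (u_l∘chart) · (c_{l'} + y_{l'})` and their exponents `w_{l'}`
  set R : Fin (m + 1) → MvPowerSeries (Fin (m + 1 + 1)) k :=
    fun l => subst (CobordantChart.chart w c) (uf l) * (C (c (strIdx Φ l)) + X (strIdx Φ l).succ) with hR
  obtain ⟨hfacf, hGf⟩ := Decoration.fChart_eq (δ := δ) (c := c) hmv hc hf
  refine ⟨satExp (δ.fChart Φ w c) + ∑ l ∈ δ.E, w (strIdx Φ l), satPart (δ.fChart Φ w c) * ∏ l ∈ δ.E, R l,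
    (∏ l ∈ δ.E, TupleGame.slice i (subst (CobordantChart.chart w c) (uf l))) *
      ∏ l ∈ δ.E.filter (fun l => ¬ c (strIdx Φ l) = 0), (C (c (strIdx Φ l)) +
        if strIdx Φ l = i then 0 else X (Fin.predAbove i (Fin.succ (strIdx Φ l)))), ?_, ?_, ?_, ?_⟩
  · -- the factorisation
    have hl : ∀ l ∈ δ.E, subst (CobordantChart.chart w c) (subst Φ (X l : MvPowerSeries (Fin (m + 1)) k)) =
        X 0 ^ w (strIdx Φ l) * R l := by
      intro l hl
      rw [subst_X hΦs, (huf l hl).2, ← coe_substAlgHom hch, map_mul, coe_substAlgHom, subst_X hch, CobordantChart.chart_apply, hR]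
      ring
    rw [Decoration.total, ← coe_substAlgHom hΦs, map_mul, map_prod, ← coe_substAlgHom hch, map_mul, map_prod, coe_substAlgHom,
      coe_substAlgHom, hfacf, Finset.prod_congr rfl hl, Finset.prod_mul_distrib, Finset.prod_pow_eq_pow_sum, pow_add]
    ring
  · -- `s ∤ H`
    intro h
    rcases hprime.dvd_or_dvd h with h1 | h2
    · exact hGf h1
    · obtain ⟨l, hl, hRl⟩ := (Prime.dvd_finsetProd_iff hprime _).mp h2
      rw [hR] at hRl
      rcases hprime.dvd_or_dvd hRl with h3 | h4
      · exact not_X_dvd_of_constantCoeff_ne_zero (by rw [constantCoeff_subst_chart_subst' hc]; exact (huf l hl).1) h3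
      · exact not_X_zero_dvd_C_add_X_succ' _ _ h4
  · -- the unit
    rw [map_mul, map_prod, map_prod]
    refine mul_ne_zero (Finset.prod_ne_zero_iff.mpr fun l hl => ?_) (Finset.prod_ne_zero_iff.mpr fun l hl => ?_)
    · rw [constantCoeff_slice, constantCoeff_subst_chart_subst' hc]; exact (huf l hl).1
    · have hne := (Finset.mem_filter.mp hl).2
      split_ifs <;> simpa [constantCoeff_X] using hne
  · -- the sliced form
    have hsR : ∀ l, TupleGame.slice i (R l) = TupleGame.slice i (subst (CobordantChart.chart w c) (uf l)) *
        (C (c (strIdx Φ l)) + if strIdx Φ l = i then 0 else X (Fin.predAbove i (Fin.succ (strIdx Φ l)))) := by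
      intro l
      rw [hR]
      unfold TupleGame.slice
      rw [← coe_substAlgHom hsl, map_mul, map_add, coe_substAlgHom, subst_C, subst_X hsl]
      congr 2
      by_cases h : strIdx Φ l = i
      · rw [if_pos (by rw [h]), if_pos h]
      · rw [if_neg (fun h' => h (Fin.succ_injective _ h')), if_neg h]
    have hzero : ∀ l ∈ δ.E.filter (fun l => c (strIdx Φ l) = 0), (C (c (strIdx Φ l)) +
        if strIdx Φ l = i then (0 : MvPowerSeries (Fin (m + 1)) k) else X (Fin.predAbove i (Fin.succ (strIdx Φ l)))) =
        X (Fin.predAbove i (Fin.succ (strIdx Φ l))) := by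
      intro l hl
      have h0 := (Finset.mem_filter.mp hl).2
      have hne : strIdx Φ l ≠ i := fun h => hci (h ▸ h0)
      rw [h0, map_zero, zero_add, if_neg hne]
    unfold Decoration.strict
    rw [slice_mul, slice_finset_prod', Finset.prod_congr rfl (fun l _ => hsR l), Finset.prod_mul_distrib,
      ← Finset.prod_filter_mul_prod_filter_not δ.E (fun l => c (strIdx Φ l) = 0)
        (fun l => C (c (strIdx Φ l)) + if strIdx Φ l = i then (0 : MvPowerSeries (Fin (m + 1)) k)
          else X (Fin.predAbove i (Fin.succ (strIdx Φ l)))),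
      Finset.prod_congr rfl hzero]
    ring

/-! ## (S1) Admissibility of the transform -/

/-- Chaining radical bounds: `a ∣ b^(M+1)`, `b ∣ c^(N+1)` ⇒ `a ∣ c^((M·N+M+N)+1)`. -/
theorem dvd_pow_of_dvd_pow_of_dvd_pow {R : Type} [CommMonoid R] {a b c : R} {M N : ℕ} (h₁ : a ∣ b ^ (M + 1)) (h₂ : b ∣ c ^ (N + 1)) :
    a ∣ c ^ (M * N + M + N + 1) := by
  have h : b ^ (M + 1) ∣ c ^ ((N + 1) * (M + 1)) := by rw [pow_mul]; exact pow_dvd_pow_of_dvd h₂ _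
  have he : (N + 1) * (M + 1) = M * N + M + N + 1 := by ring
  rw [← he]
  exact h₁.trans h

open Classical in
/-- **(S1) THE TRANSFORM OF AN ADMISSIBLE DECORATION IS ADMISSIBLE** (OURS · L1 W4.3, S-SET; CJS Def. 3.6/(3.6) in the count game).
From an admissibly decorated position `b` and a B-permissible move `(Φ, w)`, at every exceptional point `c` (chart convention), every
factorisation `b∘Φ∘chart = s^A · G` with `s ∤ G` and every live slot `i` (`c_i ≠ 0`), the transform `δ.transform Φ w c i` is admissible for
the new position `s · G|_{y_i = 0}`: (A1) by the radical transport `successor_dvd_pow` applied to `b` and the reduced total equation in both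
directions, (A2) by construction (`sqfRep`), (A3) by `not_X_zero_dvd_strict` and `not_X_newLetter_dvd_strict`. -/
theorem admissible_transform {b : MvPowerSeries (Fin (m + 1)) k} {δ : Decoration k m} {Φ : Fin (m + 1) → MvPowerSeries (Fin (m + 1)) k}
    {w : Fin (m + 1) → ℕ} {c : Fin (m + 1) → k} {A : ℕ} {G : MvPowerSeries (Fin (m + 1 + 1)) k} {i : Fin (m + 1)}
    (hadm : Admissible b δ) (hperm : IsBPermissible δ Φ w) (hc : ∀ l, w l = 0 → c l = 0)
    (hfac : subst (CobordantChart.chart w c) (subst Φ b) = X 0 ^ A * G) (hG : ¬ X 0 ∣ G) (hci : c i ≠ 0) :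
    Admissible (X 0 * TupleGame.slice i G) (δ.transform Φ w c i) := by
  obtain ⟨⟨M, N, hbT, hTb⟩, hsqf, hA3⟩ := hadm
  have hf : δ.f ≠ 0 := hsqf.ne_zero
  have hmv := hperm.1
  have hg0 : δ.strict Φ w c i ≠ 0 := Decoration.strict_ne_zero hmv hc hf hci
  obtain ⟨AT, H, U, hfacT, hH, hU, hsliceH⟩ := Decoration.total_chart_eq hperm hc hf hci
  refine ⟨?_, ?_, ?_⟩
  · -- (A1) radical equivalence
    obtain ⟨q₁, hq₁⟩ := hbT
    obtain ⟨q₂, hq₂⟩ := hTb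
    obtain ⟨K₁, hK₁⟩ := successor_dvd_pow hq₁ hmv.1 hc hfac hfacT hH i
    obtain ⟨K₂, hK₂⟩ := successor_dvd_pow hq₂ hmv.1 hc hfacT hfac hG i
    obtain ⟨N', hN'⟩ := dvd_sqfRep_pow hg0
    set P : MvPowerSeries (Fin (m + 1)) k :=
      X 0 * ∏ l ∈ δ.E.filter (fun l => c (strIdx Φ l) = 0), X (Fin.predAbove i (Fin.succ (strIdx Φ l))) with hP
    have hT' : (δ.transform Φ w c i).total = sqfRep (δ.strict Φ w c i) * P := Decoration.total_transform_eq hperm c hci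
    have hUunit : IsUnit U := isUnit_iff_constantCoeff.mpr (Ne.isUnit hU)
    refine ⟨K₁ * N' + K₁ + N', K₂, ?_, ?_⟩
    · -- `b' ∣ T'^…`: `b' ∣ (s H|)^(K₁+1)`, `s H| = U · g · P ∣ U · T'^(N'+1)`
      have h1 : X 0 * TupleGame.slice i H ∣ (δ.transform Φ w c i).total ^ (N' + 1) * U := by
        rw [hsliceH, hT', mul_pow, mul_comm _ U]
        exact mul_dvd_mul_left U (mul_dvd_mul hN' (dvd_pow_self P (Nat.succ_ne_zero N')))
      have h2 : X 0 * TupleGame.slice i H ∣ (δ.transform Φ w c i).total ^ (N' + 1) := (hUunit.dvd_mul_right).mp h1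
      exact dvd_pow_of_dvd_pow_of_dvd_pow hK₁ h2
    · -- `T' ∣ b'^…`: `T' ∣ g · P ∣ s H| ∣ (b')^(K₂+1)`
      have h1 : (δ.transform Φ w c i).total ∣ X 0 * TupleGame.slice i H := by
        rw [hsliceH, hT']
        exact (mul_dvd_mul (sqfRep_dvd _) (dvd_refl P)).trans (dvd_mul_left _ U)
      exact h1.trans hK₂
  · -- (A2) squarefree
    rw [Decoration.transform_f]
    exact squarefree_sqfRep hg0
  · -- (A3) no boundary letter divides the new equation
    intro l'' hl''
    rw [Decoration.transform_f]
    intro hdvd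
    have hdvd' : X l'' ∣ δ.strict Φ w c i := hdvd.trans (sqfRep_dvd _)
    rw [Decoration.transform_E, Finset.mem_insert] at hl''
    rcases hl'' with rfl | hmem
    · exact Decoration.not_X_zero_dvd_strict hmv hc hf hci hdvd'
    · unfold Decoration.newLetters at hmem
      obtain ⟨l, hl, rfl⟩ := Finset.mem_image.mp hmem
      obtain ⟨hlE, hcl⟩ := Finset.mem_filter.mp hl
      obtain ⟨u, hu, hΦl⟩ := strIdx_spec (hperm.2.2.2 l hlE)
      exact Decoration.not_X_newLetter_dvd_strict hmv hc hf hci (hA3 l hlE) hu hΦl hcl hdvd'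

/-! ## (S3)/(S4) The head does not rise -/

/-- **(S3) `o' ≤ o`**: the order of the transform's equation is at most the order of `f`. -/
theorem Decoration.o_transform_le {δ : Decoration k m} {Φ : Fin (m + 1) → MvPowerSeries (Fin (m + 1)) k} {w : Fin (m + 1) → ℕ}
    {c : Fin (m + 1) → k} (hperm : IsBPermissible δ Φ w) (hc : ∀ l, w l = 0 → c l = 0) (hf : δ.f ≠ 0) {i : Fin (m + 1)}
    (hci : c i ≠ 0) : (δ.transform Φ w c i).o ≤ δ.o := by
  rw [Decoration.transform_o, Decoration.o]
  have hfin : δ.f.order ≠ ⊤ := by rw [ne_eq, order_eq_top_iff]; exact hf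
  exact ENat.toNat_le_toNat ((order_sqfRep_le _).trans (Decoration.order_strict_le hperm hc hf hci)) hfin

/-- A NON-REDUCED STRICT TRANSFORM IS A HEAD DROP: if the sliced strict transform is not squarefree then `o' < o`. -/
theorem Decoration.o_transform_lt_of_not_squarefree {δ : Decoration k m} {Φ : Fin (m + 1) → MvPowerSeries (Fin (m + 1)) k}
    {w : Fin (m + 1) → ℕ} {c : Fin (m + 1) → k} (hperm : IsBPermissible δ Φ w) (hc : ∀ l, w l = 0 → c l = 0) (hf : δ.f ≠ 0)
    {i : Fin (m + 1)} (hci : c i ≠ 0) (hns : ¬ Squarefree (δ.strict Φ w c i)) : (δ.transform Φ w c i).o < δ.o := by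
  rw [Decoration.transform_o, Decoration.o]
  have hg0 : δ.strict Φ w c i ≠ 0 := Decoration.strict_ne_zero hperm.1 hc hf hci
  have hfin : δ.f.order ≠ ⊤ := by rw [ne_eq, order_eq_top_iff]; exact hf
  have hgfin : (δ.strict Φ w c i).order ≠ ⊤ := by rw [ne_eq, order_eq_top_iff]; exact hg0
  have hlt := order_sqfRep_lt hg0 hns
  have hle := Decoration.order_strict_le hperm hc hf hci
  have h1 : ((sqfRep (δ.strict Φ w c i)).order.toNat : ℕ∞) < (δ.f.order.toNat : ℕ∞) := by
    rw [ENat.coe_toNat (ne_top_of_lt hlt), ENat.coe_toNat hfin]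
    exact hlt.trans_le hle
  exact_mod_cast h1

/-- If the order did not drop, the inherited old letters are at most as many as before: `|O'| ≤ |O|`. -/
theorem Decoration.card_O_transform_le {δ : Decoration k m} {Φ : Fin (m + 1) → MvPowerSeries (Fin (m + 1)) k} {w : Fin (m + 1) → ℕ}
    {c : Fin (m + 1) → k} {i : Fin (m + 1)} (h : ¬ ((sqfRep (δ.strict Φ w c i)).order).toNat < δ.o) :
    (δ.transform Φ w c i).O.card ≤ δ.O.card := by
  classical
  rw [Decoration.transform_O_of_not_lt _ _ _ _ _ h]
  unfold Decoration.newLetters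
  exact Finset.card_image_le.trans (Finset.card_filter_le _ _)

/-- **(S4) THE HEAD DOES NOT RISE** (CJS Thm 3.16 in the count game): `(o', c') ≤ (o, c)` lexicographically — strictly if the order drops
(whatever the reset history), and with `o' = o`, `|O'| ≤ |O|` otherwise. -/
theorem Decoration.head_transform_le {δ : Decoration k m} {Φ : Fin (m + 1) → MvPowerSeries (Fin (m + 1)) k} {w : Fin (m + 1) → ℕ}
    {c : Fin (m + 1) → k} (hperm : IsBPermissible δ Φ w) (hc : ∀ l, w l = 0 → c l = 0) (hf : δ.f ≠ 0) {i : Fin (m + 1)}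
    (hci : c i ≠ 0) : (δ.transform Φ w c i).head ≤ δ.head := by
  have ho := Decoration.o_transform_le hperm hc hf hci
  rw [Decoration.head, Decoration.head, Decoration.c, Decoration.c, Prod.Lex.le_iff]
  by_cases hlt : ((sqfRep (δ.strict Φ w c i)).order).toNat < δ.o
  · left
    rwa [Decoration.transform_o]
  · right
    have heq : (δ.transform Φ w c i).o = δ.o := by
      rw [Decoration.transform_o] at ho ⊢
      omega
    exact ⟨heq, by rw [heq]; exact Nat.add_le_add_left (Decoration.card_O_transform_le hlt) _⟩

/-- The head drops STRICTLY when the order drops. -/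
theorem Decoration.head_transform_lt_of_o_lt {δ : Decoration k m} {Φ : Fin (m + 1) → MvPowerSeries (Fin (m + 1)) k} {w : Fin (m + 1) → ℕ}
    {c : Fin (m + 1) → k} {i : Fin (m + 1)} (h : (δ.transform Φ w c i).o < δ.o) : (δ.transform Φ w c i).head < δ.head := by
  rw [Decoration.head, Decoration.head, Prod.Lex.lt_iff]
  exact Or.inl h

/-! ## Packaged for the strategy: the move clause with decorations -/

/-- AT EVERY LIVE SLOT: the transform is admissible for the new position and its head did not rise. -/
theorem admissible_transform_and_head_le {b : MvPowerSeries (Fin (m + 1)) k} {δ : Decoration k m}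
    {Φ : Fin (m + 1) → MvPowerSeries (Fin (m + 1)) k} {w : Fin (m + 1) → ℕ} {c : Fin (m + 1) → k} {A : ℕ}
    {G : MvPowerSeries (Fin (m + 1 + 1)) k} {i : Fin (m + 1)} (hadm : Admissible b δ) (hperm : IsBPermissible δ Φ w)
    (hc : ∀ l, w l = 0 → c l = 0) (hfac : subst (CobordantChart.chart w c) (subst Φ b) = X 0 ^ A * G) (hG : ¬ X 0 ∣ G) (hci : c i ≠ 0) :
    Admissible (X 0 * TupleGame.slice i G) (δ.transform Φ w c i) ∧ (δ.transform Φ w c i).head ≤ δ.head :=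
  ⟨admissible_transform hadm hperm hc hfac hG hci, Decoration.head_transform_le hperm hc hadm.2.1.ne_zero hci⟩

/-- **THE MOVE CLAUSE OF A B-PERMISSIBLE MOVE, DECORATED** (OURS · L1 W4.3, S-SET for S-STRAT): from an admissibly decorated position, a B-permissible
move satisfies the count game's `MoveClause` for the goodness predicate «admissibly decorated with head `≤` the old head» (any live slot will do;
the transform supplies the decoration). The regime theorems of the line sharpen `≤` to `<` on their measures. -/
theorem moveClause_admissible_of_isBPermissible {b : MvPowerSeries (Fin (m + 1)) k} {δ : Decoration k m}
    {Φ : Fin (m + 1) → MvPowerSeries (Fin (m + 1)) k} {w : Fin (m + 1) → ℕ} (hadm : Admissible b δ) (hperm : IsBPermissible δ Φ w) :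
    MoveClause b Φ w (fun b' => ∃ δ' : Decoration k m, Admissible b' δ' ∧ δ'.head ≤ δ.head) := by
  intro c hc hc0 A G hfac hG
  obtain ⟨i, hci⟩ : ∃ i, c i ≠ 0 := Function.ne_iff.mp hc0
  exact ⟨i, hci, δ.transform Φ w c i, admissible_transform_and_head_le hadm hperm hc hfac hG hci⟩


end TameFourTupleDrop

end Summit.ResolutionOfSingularities.ResolutionOfSingularities.Theorems

end
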